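import Literature.MathematicalPhysics.QuantumFieldTheory.Balaban1983to89.B7TransferAnalyticMean
import Literature.MathematicalPhysics.QuantumFieldTheory.Balaban1983to89.BlockAveragingExpMeanLog

/-!
# The printed operation `exp[mean log]` is an analytic mean: a concrete discharger of `B7TransferAnalyticMean.IsAnalyticMean`

`B7TransferAnalyticMean` (b07 sub-cell) quantifies the ANALYTIC half of Bałaban's axioms for an abstract average `M`
of finite families of group elements ([Balaban1987RG1] p. 253, (0.5)–(0.9): «we assume that it is an analytic function …
the average is close to the identity also, and (0.8)») as the hypothesis structure `IsAnalyticMean M r K` — `M` analytic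
on the sup-norm polydisc `‖U − 1‖ < r ≤ 1` of tuples in a complete normed `ℂ`-algebra, `‖M U − 1‖ ≤ K ≤ 1/2` there,
`M 1 = 1`, `DM(1) =` the arithmetic mean — and derives from it the quantitative forms (0.8′), (0.8″) with explicit
constants `r_M = r/8`, `C_M = 64K/r²`, `C′_M = 32K/r²`, `L_M = 8K/r`.  That file asserts the structure of NO average.

This leaf DISCHARGES it for the operation the papers actually print inside (0.4) (and inside the tree's small-loop
average `ExpMeanLog.expMeanLogSU` on `SU(N)`): the exp-mean-log `ExpMeanLog.eml W = exp(|I|⁻¹ Σ_i log W_i)` on tuples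
`W : ι → 𝔸` in any complete normed `ℂ`-algebra `𝔸`, `log` = the series (21) `MatrixLog.mlog`:

* §1 `isAnalyticMean_eml : IsAnalyticMean (eml : (ι → 𝔸) → 𝔸) (1/3) (1/2)` — analytic on the polydisc `‖U − 1‖ < 1/3`
  (`ExpMeanLog.analyticAt_eml`); `‖eml U − 1‖ ≤ e^{−log(1 − 1/3)} − 1 = 1/2` there ((26): `‖log X‖ ≤ −log(1 − ‖X − 1‖)`,
  `MatrixLog.norm_mlog_le_neg_log`, and `‖e^Z − 1‖ ≤ e^{‖Z‖} − 1`, `B7TransferAnalyticMean.norm_exp_sub_one_le`);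
  `eml 1 = 1`; `D eml(1) = meanCLM` (chain rule through `hasFDerivAt_mlog_one`, `hasFDerivAt_exp_zero`); and the
  general-radius form `IsAnalyticMean eml r (r/(1 − r))` for `0 < r ≤ 1/3` (`isAnalyticMean_eml_of_le`);
* §2 hence the transfer constants of `B7TransferAnalyticMean` are NUMERIC for this operation: `r_M = 1/24`, `C_M = 288`,
  `C′_M = 144` (`‖D eml(U) W − mean W‖ ≤ 144 ‖W‖ ‖U − 1‖` for `‖U − 1‖ ≤ 1/24`), `L_M = 12`, second order at the identity
  `36 ‖V‖²`; and (0.8) holds for `eml` with ZERO remainder: `mlog (eml {exp X_j}) = |I|⁻¹ Σ_j X_j` for `max_j ‖X_j‖ < ln 2`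
  (`mlog_eml_exp`, via `B7BlockAvgLog.mlog_exp`) — the `288 ‖X‖²` of (0.8′) is an honest but idle bound here;
* §3 the `SU(N)` bridge: on the guard of `expMeanLogSU` (`dist1 W_i < δ_N = min(1/3, π/N)`) the matrix of
  `expMeanLogSU.E W` IS `eml (W_i : M_N(ℂ))` and the family lies in the analytic-mean polydisc `ball 1 (1/3)`; the
  structure holds verbatim for `𝔸 = M_N(ℂ)` with the `L²`-operator norm.

## What this is NOT

`eml` satisfies (0.5), (0.7) and the CONJUGATION form of (0.6) (`u W_i u⁻¹`; tree: `LoopAverage expMeanLogSU`,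
`BlockAveragingExpMeanLog` §3–§5) but NOT the two-sided (0.6) `M(uU_jv) = uM(U_j)v` — so this is NOT an instance of
Bałaban's inner average `M` of (0.11) (print: «axiomatric»; the Federbush mean (0.10) is a separate construction), and
NOT a statement about the transfer of [Balaban1985Averaging]'s propositions (b07's census).  What is shown is only that
the ANALYTIC half `IsAnalyticMean` is satisfied, with explicit `(r, K) = (1/3, 1/2)`, by a bona fide averaging operation
of the papers (beyond the arithmetic mean).  Every declaration is elementary ([folklore]); nothing printed is asserted
((0.4) and (26) are cited by `BlockAveragingExpMeanLog` / `MatrixLog`; no new citation); the node is OFF the spine of the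
cell's T4 DAG and is NOT an estimate of the manuscripts.

## Versions

* v1: the module.
-/

noncomputable section

open Set Metric NormedSpace

namespace Literature.MathematicalPhysics.QuantumFieldTheory.Balaban1983to89

namespace BlockAveragingEMLAnalyticMean

open MatrixLog B7TransferAnalyticMean B7BlockAvgLog
open ExpMeanLog (eml eml_def eml_eq_exp analyticAt_eml deltaSU expMeanLogSU lt_third_of_lt_deltaSU
  coe_expMeanLogSU_E)

/-! ## 1. `eml` is an analytic mean with `(r, K) = (1/3, 1/2)` -/

section Generic

variable {ι : Type*} [Fintype ι] {𝔸 : Type*} [NormedRing 𝔸] [NormedAlgebra ℂ 𝔸] [CompleteSpace 𝔸]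

omit [CompleteSpace 𝔸] in
/-- `eml W = exp (meanCLM (log W_j)_j)`: the printed operation through b07's arithmetic-mean map. [folklore] -/
theorem eml_eq_exp_meanCLM (W : ι → 𝔸) : eml W = exp (meanCLM ι 𝔸 fun j => mlog (W j)) := by
  rw [eml_eq_exp, meanCLM_apply]

omit [CompleteSpace 𝔸] in
/-- The same as an equality of functions. [folklore] -/
theorem eml_eq_fun : (eml : (ι → 𝔸) → 𝔸) = fun W => exp (meanCLM ι 𝔸 fun j => mlog (W j)) :=
  funext eml_eq_exp_meanCLM

omit [CompleteSpace 𝔸] in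
/-- `eml 1 = 1` ((0.8) to zeroth order). [folklore] -/
theorem eml_one : eml (1 : ι → 𝔸) = 1 := by
  rw [eml_eq_exp_meanCLM]
  have h0 : (fun j => mlog ((1 : ι → 𝔸) j)) = 0 := funext fun j => by simp
  rw [h0, map_zero, exp_zero]

omit [NormedAlgebra ℂ 𝔸] [CompleteSpace 𝔸] in
/-- A tuple in the polydisc `‖U − 1‖ < r` has every component within `r` of `1`. [folklore] -/
theorem norm_apply_sub_one_lt {r : ℝ} {U : ι → 𝔸} (hU : U ∈ ball (1 : ι → 𝔸) r) (i : ι) : ‖U i - 1‖ < r := by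
  rw [mem_ball, dist_eq_norm] at hU
  exact (norm_le_pi_norm (U - 1) i).trans_lt hU

/-- **«the average is close to the identity also», quantified for `eml`**: on the polydisc `‖U − 1‖ < r < 1`,
`‖eml U − 1‖ ≤ e^{−log(1 − r)} − 1 = r/(1 − r)` ((26) for each `log U_j`, the mean does not increase the sup norm,
`‖e^Z − 1‖ ≤ e^{‖Z‖} − 1`). [folklore] -/
theorem norm_eml_sub_one_le {r : ℝ} (hr1 : r < 1) {U : ι → 𝔸} (hU : U ∈ ball (1 : ι → 𝔸) r) :
    ‖eml U - 1‖ ≤ r / (1 - r) := by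
  have hi : ∀ i, ‖U i - 1‖ < r := norm_apply_sub_one_lt hU
  have hr0 : 0 < r := by
    rw [mem_ball, dist_eq_norm] at hU
    exact (norm_nonneg _).trans_lt hU
  have hlog0 : 0 ≤ -Real.log (1 - r) := by
    have : Real.log (1 - r) ≤ 0 := Real.log_nonpos (by linarith) (by linarith)
    linarith
  have hZ : ‖meanCLM ι 𝔸 (fun j => mlog (U j))‖ ≤ -Real.log (1 - r) := by
    refine (norm_meanCLM_apply_le _).trans ((pi_norm_le_iff_of_nonneg hlog0).2 fun j => ?_)
    refine (norm_mlog_le_neg_log ((hi j).trans hr1)).trans (neg_le_neg (Real.log_le_log (by linarith) ?_))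
    linarith [(hi j).le]
  rw [eml_eq_exp_meanCLM]
  calc ‖exp (meanCLM ι 𝔸 fun j => mlog (U j)) - 1‖
      ≤ Real.exp ‖meanCLM ι 𝔸 fun j => mlog (U j)‖ - 1 := norm_exp_sub_one_le _
    _ ≤ Real.exp (-Real.log (1 - r)) - 1 := by gcongr
    _ = r / (1 - r) := by
        have h1r : 1 - r ≠ 0 := by linarith
        rw [Real.exp_neg, Real.exp_log (by linarith)]
        field_simp
        ring

/-- **(0.8) to first order for `eml`**: the Fréchet derivative of `eml` at the identity tuple is the arithmetic mean
(chain rule: `U ↦ (log U_j)_j` has derivative `id` at `1`, `meanCLM` is linear, `exp` has derivative `id` at `0`).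
[folklore] -/
theorem hasFDerivAt_eml_one : HasFDerivAt (eml : (ι → 𝔸) → 𝔸) (meanCLM ι 𝔸) 1 := by
  have hL : HasFDerivAt (fun (U : ι → 𝔸) (j : ι) => mlog (U j)) (ContinuousLinearMap.id ℂ (ι → 𝔸)) 1 := by
    apply hasFDerivAt_pi''
    intro j
    rw [ContinuousLinearMap.comp_id]
    have hp : HasFDerivAt (fun U : ι → 𝔸 => U j) (ContinuousLinearMap.proj j) (1 : ι → 𝔸) :=
      (ContinuousLinearMap.proj (R := ℂ) (φ := fun _ : ι => 𝔸) j).hasFDerivAt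
    have hm : HasFDerivAt (mlog : 𝔸 → 𝔸) (1 : 𝔸 →L[ℂ] 𝔸) ((fun U : ι → 𝔸 => U j) 1) := hasFDerivAt_mlog_one
    have hc := hm.comp (1 : ι → 𝔸) hp
    rw [ContinuousLinearMap.one_def, ContinuousLinearMap.id_comp] at hc
    exact hc
  have hmean : HasFDerivAt (fun U : ι → 𝔸 => meanCLM ι 𝔸 fun j => mlog (U j)) (meanCLM ι 𝔸) 1 := by
    have hc := (meanCLM ι 𝔸).hasFDerivAt.comp (1 : ι → 𝔸) hL
    rw [ContinuousLinearMap.comp_id] at hc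
    exact hc
  have h0 : (meanCLM ι 𝔸 fun j => mlog ((1 : ι → 𝔸) j)) = 0 := by
    have : (fun j => mlog ((1 : ι → 𝔸) j)) = 0 := funext fun j => by simp
    rw [this, map_zero]
  have hexp : HasFDerivAt (exp : 𝔸 → 𝔸) (1 : 𝔸 →L[ℂ] 𝔸) (meanCLM ι 𝔸 fun j => mlog ((1 : ι → 𝔸) j)) := by
    rw [h0]; exact hasFDerivAt_exp_zero
  have hc := hexp.comp (1 : ι → 𝔸) hmean
  rw [ContinuousLinearMap.one_def, ContinuousLinearMap.id_comp] at hc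
  rw [eml_eq_fun]
  exact hc

/-- **`eml` IS AN ANALYTIC MEAN, general radius**: for `0 < r ≤ 1/3`, `IsAnalyticMean eml r (r/(1 − r))`
(`r/(1 − r) ≤ 1/2 ⟺ r ≤ 1/3`). [folklore] -/
theorem isAnalyticMean_eml_of_le {r : ℝ} (hr : 0 < r) (hr3 : r ≤ 1 / 3) :
    IsAnalyticMean (eml : (ι → 𝔸) → 𝔸) r (r / (1 - r)) where
  r_pos := hr
  r_le_one := by linarith
  K_le_half := by
    rw [div_le_iff₀ (by linarith)]
    linarith
  analyticOnNhd := fun U hU => analyticAt_eml fun i => (norm_apply_sub_one_lt hU i).trans_le (by linarith)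
  norm_sub_one_le := fun U hU => norm_eml_sub_one_le (by linarith) hU
  map_one := eml_one
  hasFDerivAt_one := hasFDerivAt_eml_one

/-- **`eml` IS AN ANALYTIC MEAN WITH `(r, K) = (1/3, 1/2)`** — a concrete discharger of
`B7TransferAnalyticMean.IsAnalyticMean` by the operation printed inside (0.4). [folklore] -/
theorem isAnalyticMean_eml : IsAnalyticMean (eml : (ι → 𝔸) → 𝔸) (1 / 3) (1 / 2) := by
  have h := isAnalyticMean_eml_of_le (ι := ι) (𝔸 := 𝔸) (r := 1 / 3) (by norm_num) le_rfl
  norm_num at h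
  exact h

/-! ## 2. Numeric transfer constants for `eml`, and (0.8) with zero remainder -/

/-- **`C′_M = 144`**: `‖D eml(U) W − mean W‖ ≤ 144 ‖W‖ ‖U − 1‖` for `‖U − 1‖ ≤ 1/24`
(`IsAnalyticMean.norm_fderiv_sub_mean_le` at `(1/3, 1/2)`). [folklore] -/
theorem norm_fderiv_eml_sub_mean_le {U : ι → 𝔸} (hU : ‖U - 1‖ ≤ 1 / 24) (W : ι → 𝔸) :
    ‖fderiv ℂ (eml : (ι → 𝔸) → 𝔸) U W - meanCLM ι 𝔸 W‖ ≤ 144 * ‖W‖ * ‖U - 1‖ := by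
  have h := (isAnalyticMean_eml (ι := ι) (𝔸 := 𝔸)).norm_fderiv_sub_mean_le (U := U) (by linarith) W
  calc _ ≤ 32 * (1 / 2) * ‖W‖ * ‖U - 1‖ / (1 / 3) ^ 2 := h
    _ = 144 * ‖W‖ * ‖U - 1‖ := by ring

/-- **`L_M = 12`**: `‖eml (U + V) − eml U‖ ≤ 12 ‖V‖` for `‖U − 1‖ ≤ 1/6`, `‖V‖ ≤ 1/24`
(`IsAnalyticMean.norm_sub_le_near_one` at `(1/3, 1/2)`). [folklore] -/
theorem norm_eml_add_sub_eml_le {U V : ι → 𝔸} (hU : ‖U - 1‖ ≤ 1 / 6) (hV : ‖V‖ ≤ 1 / 24) :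
    ‖eml (U + V) - eml U‖ ≤ 12 * ‖V‖ := by
  have h := (isAnalyticMean_eml (ι := ι) (𝔸 := 𝔸)).norm_sub_le_near_one (U := U) (V := V)
    (by linarith) (by linarith)
  calc _ ≤ 8 * (1 / 2) / (1 / 3) * ‖V‖ := h
    _ = 12 * ‖V‖ := by ring

/-- **Derivative bound `‖D eml(U) W‖ ≤ 6 ‖W‖`** for `‖U − 1‖ ≤ 1/6`
(`IsAnalyticMean.norm_fderiv_apply_le_near_one` at `(1/3, 1/2)`). [folklore] -/
theorem norm_fderiv_eml_apply_le {U : ι → 𝔸} (hU : ‖U - 1‖ ≤ 1 / 6) (W : ι → 𝔸) :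
    ‖fderiv ℂ (eml : (ι → 𝔸) → 𝔸) U W‖ ≤ 6 * ‖W‖ := by
  have h := (isAnalyticMean_eml (ι := ι) (𝔸 := 𝔸)).norm_fderiv_apply_le_near_one (U := U) (by linarith) W
  calc _ ≤ 4 * (1 / 2) / (1 / 3) * ‖W‖ := h
    _ = 6 * ‖W‖ := by ring

/-- **Second order at the identity tuple, `36 ‖V‖²`**: `‖eml (1 + V) − 1 − mean V‖ ≤ 36 ‖V‖²` for `‖V‖ ≤ 1/12`
(`IsAnalyticMean.norm_sub_one_sub_mean_le` at `(1/3, 1/2)`). [folklore] -/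
theorem norm_eml_one_add_sub_sub_mean_le {V : ι → 𝔸} (hV : ‖V‖ ≤ 1 / 12) :
    ‖eml (1 + V) - 1 - meanCLM ι 𝔸 V‖ ≤ 36 * ‖V‖ ^ 2 := by
  have h := (isAnalyticMean_eml (ι := ι) (𝔸 := 𝔸)).norm_sub_one_sub_mean_le (V := V) (by linarith)
  calc _ ≤ 8 * (1 / 2) * ‖V‖ ^ 2 / (1 / 3) ^ 2 := h
    _ = 36 * ‖V‖ ^ 2 := by ring

/-- **`r_M = 1/24`, `C_M = 288`**: (0.8′) for `eml` from the abstract engine —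
`‖mlog (eml {exp X_j}) − mean X‖ ≤ 288 ‖X‖²` for `‖X‖ ≤ 1/24` (`IsAnalyticMean.norm_mlog_exp_sub_mean_le` at
`(1/3, 1/2)`; idle for `eml`, see `mlog_eml_exp`). [folklore] -/
theorem norm_mlog_eml_exp_sub_mean_le {X : ι → 𝔸} (hX : ‖X‖ ≤ 1 / 24) :
    ‖mlog (eml fun j => exp (X j)) - meanCLM ι 𝔸 X‖ ≤ 288 * ‖X‖ ^ 2 := by
  have h := (isAnalyticMean_eml (ι := ι) (𝔸 := 𝔸)).norm_mlog_exp_sub_mean_le (X := X) (by linarith)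
  calc _ ≤ 64 * (1 / 2) * ‖X‖ ^ 2 / (1 / 3) ^ 2 := h
    _ = 288 * ‖X‖ ^ 2 := by ring

/-- On `{exp X_j}` with `max_j ‖X_j‖ < ln 2`, `eml {exp X_j} = exp (mean X)` (`log ∘ exp = id` termwise,
`B7BlockAvgLog.mlog_exp`). [folklore] -/
theorem eml_exp {X : ι → 𝔸} (hX : ‖X‖ < Real.log 2) : eml (fun j => exp (X j)) = exp (meanCLM ι 𝔸 X) := by
  rw [eml_eq_exp_meanCLM]
  have h : (fun j => mlog (exp (X j))) = X := funext fun j => mlog_exp ((norm_le_pi_norm X j).trans_lt hX)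
  rw [h]

/-- **(0.8) WITH ZERO REMAINDER for `eml`**: `log (eml {exp X_j}) = |I|⁻¹ Σ_j X_j` for `max_j ‖X_j‖ < ln 2` — the
«higher order terms» of (0.8) vanish identically for the exp-mean-log. [folklore] -/
theorem mlog_eml_exp {X : ι → 𝔸} (hX : ‖X‖ < Real.log 2) : mlog (eml fun j => exp (X j)) = meanCLM ι 𝔸 X := by
  rw [eml_exp hX]
  exact mlog_exp ((norm_meanCLM_apply_le X).trans_lt hX)

end Generic

/-! ## 3. The `SU(N)` bridge: the printed small-loop average on its guard is `eml`, inside the polydisc -/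

section SUN

open scoped Matrix.Norms.L2Operator

variable {n : Type*} [Fintype n] [DecidableEq n] [Nonempty n]

/-- On the guard `dist1 W_i < δ_N` of `expMeanLogSU`, the matrix of `expMeanLogSU.E W` is `eml (W_i : M_N(ℂ))`.
[folklore] -/
theorem coe_expMeanLogSU_E_eq_eml {m : ℕ} (W : Fin (m + 1) → Matrix.specialUnitaryGroup n ℂ)
    (hW : ∀ i, dist1 (W i) < deltaSU n) :
    (((expMeanLogSU (n := n)).E W : Matrix.specialUnitaryGroup n ℂ) : Matrix n n ℂ) =
      eml fun i => (W i : Matrix n n ℂ) := by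
  rw [coe_expMeanLogSU_E W hW, eml_def, Fintype.card_fin]

/-- On the guard, the matrix family lies in the analytic-mean polydisc `ball 1 (1/3)` (`δ_N ≤ 1/3`). [folklore] -/
theorem coe_mem_ball_third {m : ℕ} (W : Fin (m + 1) → Matrix.specialUnitaryGroup n ℂ)
    (hW : ∀ i, dist1 (W i) < deltaSU n) :
    (fun i => (W i : Matrix n n ℂ)) ∈ ball (1 : Fin (m + 1) → Matrix n n ℂ) (1 / 3) := by
  rw [mem_ball, dist_eq_norm, pi_norm_lt_iff (by norm_num : (0 : ℝ) < 1 / 3)]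
  exact fun i => lt_third_of_lt_deltaSU (hW i)

omit [Nonempty n] in
/-- The structure for matrix tuples with the `L²`-operator norm, every arity: `IsAnalyticMean eml (1/3) (1/2)` on
`(Fin (m+1) → M_N(ℂ)) → M_N(ℂ)`. [folklore] -/
theorem isAnalyticMean_eml_matrix (m : ℕ) :
    IsAnalyticMean (eml : (Fin (m + 1) → Matrix n n ℂ) → Matrix n n ℂ) (1 / 3) (1 / 2) :=
  isAnalyticMean_eml

/-- Hence, on the guard, the printed `SU(N)` average differs from `1` by at most `1/2` in operator norm, read off the
abstract structure (a consistency check; `BlockAveragingExpMeanLog` has sharper bounds). [folklore] -/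
theorem norm_coe_expMeanLogSU_E_sub_one_le {m : ℕ} (W : Fin (m + 1) → Matrix.specialUnitaryGroup n ℂ)
    (hW : ∀ i, dist1 (W i) < deltaSU n) :
    ‖(((expMeanLogSU (n := n)).E W : Matrix.specialUnitaryGroup n ℂ) : Matrix n n ℂ) - 1‖ ≤ 1 / 2 := by
  rw [coe_expMeanLogSU_E_eq_eml W hW]
  exact (isAnalyticMean_eml_matrix m).norm_sub_one_le _ (coe_mem_ball_third W hW)

end SUN

end BlockAveragingEMLAnalyticMean

end Literature.MathematicalPhysics.QuantumFieldTheory.Balaban1983to89
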